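import Mathlib
import HarnessLib
import Summits.ValiantsHypothesis.ValiantsHypothesis.Theses.MonotoneRestoration
import Literature.Computability.AlgebraicComplexity.ArithCircuit
import Literature.Computability.AlgebraicComplexity.ArithCircuitProofs
import Literature.Computability.AlgebraicComplexity.MonotoneStructure
import Literature.Computability.AlgebraicComplexity.PermanentIrreducible
import Literature.ModelTheory.FiniteModelTheory.CkEquiv
import Summits.ValiantsHypothesis.ValiantsHypothesis.Theorems.MonotoneRestorationMonotoneRestorationQPCosetCount
import Summits.ValiantsHypothesis.ValiantsHypothesis.Theorems.MonotoneRestorationMonotoneRestorationQPSymmetricLB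
import Summits.ValiantsHypothesis.ValiantsHypothesis.Theorems.MonotoneRestorationMonotoneRestorationQPSupportSymmetrisation
import Summits.ValiantsHypothesis.ValiantsHypothesis.Theorems.MonotoneRestorationMonotoneRestorationQPSparseRegime
import Summits.ValiantsHypothesis.ValiantsHypothesis.Theorems.MonotoneRestorationMonotoneRestorationQPBeta
import Literature.Computability.AlgebraicComplexity.SymmetricArithCircuit
import Literature.Computability.AlgebraicComplexity.DawarWilsenach2025Proofs
import Literature.GroupTheory.PermutationGroups.SmallIndexSubgroups
import Summits.ValiantsHypothesis.ValiantsHypothesis.Theorems.MonotoneRestorationQP.Negative.LoadBearing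
import Summits.ValiantsHypothesis.ValiantsHypothesis.Theorems.MonotoneRestorationMonotoneRestorationQPPermSupportCount
import Summits.ValiantsHypothesis.ValiantsHypothesis.Theorems.MonotoneRestorationMonotoneRestorationQPVariants19272

/-! TTRL-lite variant V19233 of stmt-ValiantsHypothesis-15886

Target `stub_esymmRowSums_complexity` (slug `valian15886-stub-esymmrowsums-comp`), move `specialise`
(BOUNDARY, lower side, exponent `c₀ := 1`): the linear size bound `L(E_n) ≤ n + 2` for
`E_n = e_{⌊n/2⌋}(R₁, …, R_n)`, `R_i = Σ_j x_{i,j}` over `ℝ≥0`, is FALSE. Witness `n = 4`: by the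
variable-counting floor `n² ≤ 2·L(E_n) + 1` for `n ≥ 2`
(`stub_esymmRowSums_complexity_var19272`, from `card_vars_le_complexity` and the fact that `E_n`
mentions all `n²` variables), `16 ≤ 2·L(E_4) + 1`, so `L(E_4) ≥ 8 > 6 = 4 + 2`.
-/

-- `Summit.ValiantsHypothesis.ValiantsHypothesis.…` is the tree's mandated single-conjunct layout
-- (Sub = Summit), so the duplicated namespace component is intended.
set_option linter.dupNamespace false

namespace Summit.ValiantsHypothesis.ValiantsHypothesis.Theorems

open Summit.ValiantsHypothesis.ValiantsHypothesis.Theses.MonotoneRestoration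
open Literature.Computability.AlgebraicComplexity

/-- **TTRL-lite variant V19233 (boundary probe, FALSE)** of `stub_esymmRowSums_complexity`
(`stmt-ValiantsHypothesis-15886`): it is *not* the case that for every `n` the fan-in-two circuit
complexity over `ℝ≥0` of `E_n = e_{⌊n/2⌋}(R₁, …, R_n)` (`R_i = Σ_j x_{i,j}`) is at most `n + 2`.
Witness `n = 4`: `E_4 = e_2(R_1, …, R_4)` mentions all `16` variables and a fan-in-two circuit of
size `s` reads at most `2s + 1` variables, so `16 ≤ 2·L(E_4) + 1`
(`stub_esymmRowSums_complexity_var19272`), i.e. `L(E_4) ≥ 8 > 6`. So the exponent `c₀ = 1` with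
constant `1` is below the true (quadratic) growth of the witness family.
[cite: Burgisser2000, Def. 2.1 / Rem. 2.2] -/
theorem stub_esymmRowSums_complexity_var19233_false :
    ¬ (∀ n : ℕ, complexity (MvPolynomial.bind₁ (fun i : Fin n => ∑ j : Fin n,
      MvPolynomial.X (i, j)) (MvPolynomial.esymm (Fin n) NNReal (n / 2))) ≤ n + 2) := by
  intro h
  have hub := h 4
  have hlb := stub_esymmRowSums_complexity_var19272 4 (by norm_num)
  omega

end Summit.ValiantsHypothesis.ValiantsHypothesis.Theorems
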